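import Summits.Parity.GeneralizedHardyLittlewood.Theorems.FordMaynardSieveConst01651SieveConst01651KernelForm
import HarnessLib

/-!
# Route `FordMaynardSieveConst01651`, target `SieveConst01651` (stmt-Parity-19185), line `sieve_decomposition`,
# stub `stub_coneCertClosed`: cuts and low-dimensional evaluations of the ordered slice functions `S⁰_r`

Helper file (def-free), continuation of `…KernelForm` / `…ConeKernel` (K. Ford, J. Maynard, *On the theory of prime
producing sieves*, arXiv:2407.14368, Theorem 7.3 (a)).  In the kernel normal form of `V(ν, g₀)` the cone data enter
only through the ORDERED slice functions `S⁰_r(t) = ∫_{|v| = t} 𝟙[vᵢ > ν, v₁ ≤ ⋯ ≤ v_r] g₀,ᵣ(v)/∏ vᵢ`.  Here: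

* `sliceFnOrd_eq_zero_of_half_lt` — under the closed support clause (`|v| ≤ 1/2`), `S⁰_r(t) = 0` for `t > 1/2`
  (`r ≥ 1`): the `t`-integrals of the normal form live on `(rν, 1/2]`;
* `sliceFnOrd_eq_zero_of_le` — `S⁰_r(t) = 0` for `t ≤ rν` (the box misses the slice), and
  `sliceFnOrd_eq_zero_of_dim` — `S⁰_r ≡ 0` as soon as `rν ≥ 1/2` (at `ν = 0.1651`: only `r ≤ 3` survive);
* `sliceFnOrd_one` — `S⁰_1(t) = 𝟙[t > ν]·g₀,₁(t)/t`;
* `sliceFnOrd_two` — `S⁰_2(t) = ∫_{u ∈ (0,t)} 𝟙[ν < u ≤ t − u]·g₀,₂(u, t−u)/(u(t−u)) du` (one-dimensional; for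
  cell-wise constant `g₀,₂` a finite sum of logarithms by `kernel_two_window_eq_log`).

References: [FordMaynard2024PrimeSieves] arXiv:2407.14368, Theorem 7.3 (a), (7.1), §4.2 (Notational convention).
-/

noncomputable section

open MeasureTheory Set Finset
open scoped Classical
open Literature.NumberTheory.Sieve Literature.NumberTheory.Sieve.FordMaynard
open Summit.Parity.GeneralizedHardyLittlewood.FordMaynardNoSieveConst0164NegWitness0164

namespace Summit.Parity.GeneralizedHardyLittlewood.FordMaynardSieveConst01651SieveConst01651

/-! ### Vanishing of the ordered slice functions -/

/-- **`S⁰_r(t) = 0` for `t > 1/2`** (`r ≥ 1`) under the closed support clause `|v| ≤ 1/2` on ordered vectors.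
[cite: FordMaynard2024PrimeSieves, (7.1) (𝒢₁: |x| ≤ γ = 1/2)] -/
theorem sliceFnOrd_eq_zero_of_half_lt {ν : ℝ} {g₀ : VecFn}
    (hsupp : ∀ (k : ℕ) (x : Fin k → ℝ), Monotone x → g₀ k x ≠ 0 → k = 0 ∨ ((∀ i, ν < x i) ∧ ∑ i, x i ≤ 1 / 2))
    {r : ℕ} (hr : 1 ≤ r) {t : ℝ} (ht : 1 / 2 < t) :
    sliceIntegral r t (fun v => if (∀ i, ν < v i) ∧ Monotone v then g₀ r v / ∏ i, v i else 0) = 0 := by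
  have h : sliceIntegral r t (fun v => if (∀ i, ν < v i) ∧ Monotone v then g₀ r v / ∏ i, v i else 0) =
      sliceIntegral r t (fun _ => 0) := by
    refine sliceIntegral_congr fun v _ hvs => ?_
    split_ifs with hv
    · have hz : g₀ r v = 0 := by
        by_contra hne
        rcases hsupp r v hv.2 hne with h0 | ⟨-, hs⟩
        · omega
        · rw [hvs] at hs; linarith
      rw [hz, zero_div]
    · rfl
  rw [h, sliceIntegral_zero]

/-- **`S⁰_r(t) = 0` for `t ≤ rν`** (`r ≥ 1`): the box `vᵢ > ν` misses the slice `|v| = t`. [folklore] -/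
theorem sliceFnOrd_eq_zero_of_le {ν : ℝ} (g₀ : VecFn) {r : ℕ} (hr : 1 ≤ r) {t : ℝ} (ht : t ≤ r * ν) :
    sliceIntegral r t (fun v => if (∀ i, ν < v i) ∧ Monotone v then g₀ r v / ∏ i, v i else 0) = 0 := by
  have h : sliceIntegral r t (fun v => if (∀ i, ν < v i) ∧ Monotone v then g₀ r v / ∏ i, v i else 0) =
      sliceIntegral r t (fun _ => 0) := by
    refine sliceIntegral_congr fun v _ hvs => ?_
    have : ¬ ((∀ i, ν < v i) ∧ Monotone v) := by
      rintro ⟨hb, -⟩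
      have hlt : (r : ℝ) * ν < ∑ i, v i := by
        calc (r : ℝ) * ν = ∑ _i : Fin r, ν := by simp
          _ < ∑ i, v i := by
            refine Finset.sum_lt_sum_of_nonempty ?_ (fun i _ => hb i)
            rw [Finset.univ_nonempty_iff]
            exact ⟨⟨0, hr⟩⟩
      linarith
    rw [if_neg this]
  rw [h, sliceIntegral_zero]

/-- **`S⁰_r ≡ 0` when `rν ≥ 1/2`** (`r ≥ 1`): a monotone vector in the support has `r` components `> ν` and sum
`≤ 1/2`.  At `ν = 0.1651` only `r ≤ 3` survive. [cite: FordMaynard2024PrimeSieves, (7.1) and §8.2 ("at most three components")] -/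
theorem sliceFnOrd_eq_zero_of_dim {ν : ℝ} {g₀ : VecFn}
    (hsupp : ∀ (k : ℕ) (x : Fin k → ℝ), Monotone x → g₀ k x ≠ 0 → k = 0 ∨ ((∀ i, ν < x i) ∧ ∑ i, x i ≤ 1 / 2))
    {r : ℕ} (hr : 1 ≤ r) (hrν : 1 / 2 ≤ r * ν) (t : ℝ) :
    sliceIntegral r t (fun v => if (∀ i, ν < v i) ∧ Monotone v then g₀ r v / ∏ i, v i else 0) = 0 := by
  by_cases ht : 1 / 2 < t
  · exact sliceFnOrd_eq_zero_of_half_lt hsupp hr ht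
  · exact sliceFnOrd_eq_zero_of_le g₀ hr (by linarith)

/-! ### Dimensions one and two -/

/-- **`S⁰_1(t) = 𝟙[t > ν]·g₀,₁(t)/t`** (`ν > 0`; the slice in dimension one is the point `v = (t)`).
[cite: FordMaynard2024PrimeSieves, §4.2 (Notational convention)] -/
theorem sliceFnOrd_one {ν : ℝ} (hν : 0 < ν) (g₀ : VecFn) (t : ℝ) :
    sliceIntegral 1 t (fun v => if (∀ i, ν < v i) ∧ Monotone v then g₀ 1 v / ∏ i, v i else 0) =
      if ν < t then g₀ 1 (fun _ => t) / t else 0 := by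
  rw [sliceIntegral_one]
  have hmono : Monotone (fun _ : Fin 1 => t) := fun _ _ _ => le_rfl
  by_cases hνt : ν < t
  · rw [if_pos (hν.trans hνt), if_pos hνt, if_pos ⟨fun _ => hνt, hmono⟩]
    simp
  · rw [if_neg hνt]
    by_cases h0 : 0 < t
    · rw [if_pos h0, if_neg (fun h => hνt (h.1 0))]
    · rw [if_neg h0]

/-- **`S⁰_2(t)` as a one-dimensional integral**: `∫_{u ∈ (0,t)} 𝟙[ν < u, u ≤ t − u]·g₀,₂(u, t−u)/(u(t−u)) du`
(on the slice `v = (u, t − u)`; the box `vᵢ > ν` and the ordering `v₀ ≤ v₁` become `ν < u ≤ t/2`, the bound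
`t − u > ν` being implied).  For cell-wise constant `g₀,₂` this is a finite sum of window integrals
`∫ 𝟙[a<u<b]/(u(t−u)) = (log(b/(t−b)) − log(a/(t−a)))/t` (`kernel_two_window_eq_log`).
[cite: FordMaynard2024PrimeSieves, §4.2 (Notational convention), Theorem 7.3 (a) (k = 2 cells)] -/
theorem sliceFnOrd_two (ν : ℝ) (g₀ : VecFn) (t : ℝ) :
    sliceIntegral 2 t (fun v => if (∀ i, ν < v i) ∧ Monotone v then g₀ 2 v / ∏ i, v i else 0) =
      ∫ u in Set.Ioo 0 t, if ν < u ∧ u ≤ t - u then g₀ 2 ![u, t - u] / (u * (t - u)) else 0 := by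
  rw [sliceIntegral_two_eq_intervalIntegral]
  refine setIntegral_congr_fun measurableSet_Ioo fun u hu => ?_
  have hprod : ∏ i, (![u, t - u] : Fin 2 → ℝ) i = u * (t - u) := by
    rw [Fin.prod_univ_two]; rfl
  have hmono : Monotone (![u, t - u] : Fin 2 → ℝ) ↔ u ≤ t - u := by
    constructor
    · intro h
      exact h (show (0 : Fin 2) ≤ 1 from Fin.zero_le _)
    · intro h i j hij
      fin_cases i <;> fin_cases j
      · exact le_rfl
      · exact h
      · exact absurd hij (by decide)
      · exact le_rfl
  have hbox : (∀ i, ν < (![u, t - u] : Fin 2 → ℝ) i) ↔ ν < u ∧ ν < t - u := by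
    rw [Fin.forall_fin_two]; rfl
  have hiff : ((∀ i, ν < (![u, t - u] : Fin 2 → ℝ) i) ∧ Monotone (![u, t - u] : Fin 2 → ℝ)) ↔
      (ν < u ∧ u ≤ t - u) := by
    rw [hbox, hmono]
    constructor
    · rintro ⟨⟨h1, -⟩, h3⟩; exact ⟨h1, h3⟩
    · rintro ⟨h1, h3⟩; exact ⟨⟨h1, by linarith⟩, h3⟩
  simp only [hiff, hprod]

end Summit.Parity.GeneralizedHardyLittlewood.FordMaynardSieveConst01651SieveConst01651

end
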